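import Literature.Analysis.SpecialFunctions.SelbergAomotoCalculus
import Mathlib.Logic.Equiv.Fintype
import HarnessLib

/-!
# Aomoto's recurrence for the Selberg integral

The combinatorial half of K. Aomoto's proof of Selberg's formula (K. Aomoto, SIAM J. Math. Anal.
18 (1987) 545–549; G. E. Andrews, R. Askey, R. Roy, *Special Functions* (1999), §8.2, Thm. 8.1.1;
survey: P. J. Forrester, S. O. Warnaar, Bull. AMS 45 (2008)). Writing
`I(K) = ∫_{[0,1]^{m+1}} (∏_{i∈K} tᵢ) W(t) dt` for the Selberg weight `W` with parameters
`a, b, c ≥ 1`, the calculus identity of `SelbergAomotoCalculus` is symmetrised under the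
transpositions `0 ↔ j` to give Aomoto's first-order recurrence

  `(a + (m - |K|)c) I(K) = (a + b + (2m - |K|)c) I(K ∪ {0})`     (`0 ∉ K`),

and, since `I(K)` depends only on `|K|`, the chain `I(∅) → ⋯ → I(univ)` yields

  `S_{m+1}(a+1, b, c) = S_{m+1}(a, b, c) · ∏_{j=0}^{m} (a + jc)/(a + b + (m+j)c)`,

the integral side of the recurrence whose product side is `selbergProduct_add_one`.

Everything here is fully proved; no named facts.
-/

noncomputable section

open MeasureTheory Real Finset Set

namespace Literature.Analysis.SpecialFunctions

namespace Selberg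

variable {m : ℕ} {a b c : ℝ}

/-! ### The moments `I(K)` depend only on `|K|` -/

/-- Relabelling: `∫ (∏_{i∈K.map σ} tᵢ) W = ∫ (∏_{i∈K} tᵢ) W`. [folklore] -/
theorem integral_prod_map_perm (n : ℕ) (a b c : ℝ) (K : Finset (Fin n)) (σ : Equiv.Perm (Fin n)) :
    ∫ t in cube n, (∏ i ∈ K.map σ.toEmbedding, t i) * weight n a b c t =
      ∫ t in cube n, (∏ i ∈ K, t i) * weight n a b c t := by
  rw [← integral_cube_comp_perm σ.symm
    (fun t => (∏ i ∈ K.map σ.toEmbedding, t i) * weight n a b c t)]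
  refine setIntegral_congr_fun (measurableSet_cube n) fun t _ => ?_
  simp only [weight_comp_perm, Finset.prod_map, Function.comp_apply, Equiv.coe_toEmbedding,
    Equiv.symm_apply_apply]

/-- **`I(K)` depends only on `|K|`**: two index sets of the same size are exchanged by a
permutation (Mathlib's `Equiv.Perm.exists_map_finset_eq`), and the integral is invariant under
relabelling. [folklore] -/
theorem integral_prod_eq_of_card_eq (n : ℕ) (a b c : ℝ) {K L : Finset (Fin n)}
    (h : K.card = L.card) :
    ∫ t in cube n, (∏ i ∈ K, t i) * weight n a b c t =
      ∫ t in cube n, (∏ i ∈ L, t i) * weight n a b c t := by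
  obtain ⟨σ, rfl⟩ := Equiv.Perm.exists_map_finset_eq K L h
  exact (integral_prod_map_perm n a b c K σ).symm

/-! ### Symmetrisation under `0 ↔ j` -/

/-- The transposition `0 ↔ j` fixes every index of a set containing neither. [folklore] -/
theorem prod_comp_swap_of_not_mem {K : Finset (Fin (m + 1))} {j : Fin (m + 1)}
    (h0 : (0 : Fin (m + 1)) ∉ K) (hj : j ∉ K) (t : Fin (m + 1) → ℝ) :
    ∏ i ∈ K, t (Equiv.swap 0 j i) = ∏ i ∈ K, t i := by
  refine prod_congr rfl fun i hi => ?_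
  have hi0 : i ≠ 0 := fun h => h0 (h ▸ hi)
  have hij : i ≠ j := fun h => hj (h ▸ hi)
  rw [Equiv.swap_apply_of_ne_of_ne hi0 hij]

/-- **Symmetrisation, `j ∉ K`**: `2 ∫ t₀(1-t₀) e_K dW₀ⱼ = ∫ (1 - t₀ - tⱼ) e_K W`. [folklore] -/
theorem two_mul_integral_dWeight_of_not_mem (ha : 1 ≤ a) (hb : 1 ≤ b) (hc : 1 ≤ c)
    {K : Finset (Fin (m + 1))} (h0 : (0 : Fin (m + 1)) ∉ K) {j : Fin (m + 1)} (hj0 : j ≠ 0)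
    (hj : j ∉ K) :
    2 * ∫ t in cube (m + 1), t 0 * (1 - t 0) * (∏ i ∈ K, t i) * dWeight (m + 1) a b c 0 j t =
      ∫ t in cube (m + 1), (1 - t 0 - t j) * (∏ i ∈ K, t i) * weight (m + 1) a b c t := by
  set τ := Equiv.swap (0 : Fin (m + 1)) j with hτ
  set F : (Fin (m + 1) → ℝ) → ℝ := fun t =>
    t 0 * (1 - t 0) * (∏ i ∈ K, t i) * dWeight (m + 1) a b c 0 j t with hF
  have hswap : ∀ t, F (t ∘ τ) = -(t j * (1 - t j) * (∏ i ∈ K, t i) *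
      dWeight (m + 1) a b c 0 j t) := by
    intro t
    simp only [hF, hτ, dWeight_comp_swap, Function.comp_apply, Equiv.swap_apply_left,
      prod_comp_swap_of_not_mem h0 hj]
    ring
  have hcont : Continuous F := by
    have := continuous_dWeight ha hb hc (0 : Fin (m + 1)) j
    have h2 : Continuous fun t : Fin (m + 1) → ℝ => ∏ i ∈ K, t i :=
      continuous_finsetProd _ fun i _ => continuous_apply i
    simp only [hF]
    fun_prop
  have hcontτ : Continuous fun t => F (t ∘ τ) := by
    simp only [hswap]
    have := continuous_dWeight ha hb hc (0 : Fin (m + 1)) j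
    have h2 : Continuous fun t : Fin (m + 1) → ℝ => ∏ i ∈ K, t i :=
      continuous_finsetProd _ fun i _ => continuous_apply i
    fun_prop
  have hint : IntegrableOn F (cube (m + 1)) :=
    hcont.continuousOn.integrableOn_compact (isCompact_cube _)
  have hintτ : IntegrableOn (fun t => F (t ∘ τ)) (cube (m + 1)) :=
    hcontτ.continuousOn.integrableOn_compact (isCompact_cube _)
  calc 2 * ∫ t in cube (m + 1), F t
      = (∫ t in cube (m + 1), F t) + ∫ t in cube (m + 1), F t := two_mul _
    _ = (∫ t in cube (m + 1), F t) + ∫ t in cube (m + 1), F (t ∘ τ) := by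
        rw [integral_cube_comp_perm τ F]
    _ = ∫ t in cube (m + 1), (F t + F (t ∘ τ)) := (integral_add hint hintτ).symm
    _ = ∫ t in cube (m + 1), (1 - t 0 - t j) * (∏ i ∈ K, t i) * weight (m + 1) a b c t := by
        refine setIntegral_congr_fun (measurableSet_cube _) fun t _ => ?_
        rw [hswap t, ← sub_mul_dWeight a b hc hj0.symm t]
        simp only [hF]
        ring

/-- **Symmetrisation, `j ∈ K`**: `2 ∫ t₀(1-t₀) e_K dW₀ⱼ = -∫ t₀ e_K W`. [folklore] -/
theorem two_mul_integral_dWeight_of_mem (ha : 1 ≤ a) (hb : 1 ≤ b) (hc : 1 ≤ c)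
    {K : Finset (Fin (m + 1))} (h0 : (0 : Fin (m + 1)) ∉ K) {j : Fin (m + 1)} (hj : j ∈ K) :
    2 * ∫ t in cube (m + 1), t 0 * (1 - t 0) * (∏ i ∈ K, t i) * dWeight (m + 1) a b c 0 j t =
      -∫ t in cube (m + 1), t 0 * (∏ i ∈ K, t i) * weight (m + 1) a b c t := by
  have hj0 : j ≠ 0 := fun h => h0 (h ▸ hj)
  set τ := Equiv.swap (0 : Fin (m + 1)) j with hτ
  set K' := K.erase j with hK'
  have hK : ∀ t : Fin (m + 1) → ℝ, ∏ i ∈ K, t i = t j * ∏ i ∈ K', t i := fun t =>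
    (Finset.mul_prod_erase K t hj).symm
  have h0' : (0 : Fin (m + 1)) ∉ K' := fun h => h0 (Finset.mem_of_mem_erase h)
  have hj' : j ∉ K' := Finset.notMem_erase j K
  set F : (Fin (m + 1) → ℝ) → ℝ := fun t =>
    t 0 * (1 - t 0) * (∏ i ∈ K, t i) * dWeight (m + 1) a b c 0 j t with hF
  have hswap : ∀ t, F (t ∘ τ) = -(t j * (1 - t j) * (t 0 * ∏ i ∈ K', t i) *
      dWeight (m + 1) a b c 0 j t) := by
    intro t
    simp only [hF, hK, hτ, dWeight_comp_swap, Function.comp_apply, Equiv.swap_apply_left,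
      Equiv.swap_apply_right, prod_comp_swap_of_not_mem h0' hj']
    ring
  have hcont : Continuous F := by
    have := continuous_dWeight ha hb hc (0 : Fin (m + 1)) j
    have h2 : Continuous fun t : Fin (m + 1) → ℝ => ∏ i ∈ K, t i :=
      continuous_finsetProd _ fun i _ => continuous_apply i
    simp only [hF]
    fun_prop
  have hcontτ : Continuous fun t => F (t ∘ τ) := by
    simp only [hswap]
    have := continuous_dWeight ha hb hc (0 : Fin (m + 1)) j
    have h2 : Continuous fun t : Fin (m + 1) → ℝ => ∏ i ∈ K', t i :=
      continuous_finsetProd _ fun i _ => continuous_apply i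
    fun_prop
  have hint : IntegrableOn F (cube (m + 1)) :=
    hcont.continuousOn.integrableOn_compact (isCompact_cube _)
  have hintτ : IntegrableOn (fun t => F (t ∘ τ)) (cube (m + 1)) :=
    hcontτ.continuousOn.integrableOn_compact (isCompact_cube _)
  calc 2 * ∫ t in cube (m + 1), F t
      = (∫ t in cube (m + 1), F t) + ∫ t in cube (m + 1), F t := two_mul _
    _ = (∫ t in cube (m + 1), F t) + ∫ t in cube (m + 1), F (t ∘ τ) := by
        rw [integral_cube_comp_perm τ F]
    _ = ∫ t in cube (m + 1), (F t + F (t ∘ τ)) := (integral_add hint hintτ).symm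
    _ = ∫ t in cube (m + 1), -(t 0 * (∏ i ∈ K, t i) * weight (m + 1) a b c t) := by
        refine setIntegral_congr_fun (measurableSet_cube _) fun t _ => ?_
        rw [hswap t, ← sub_mul_dWeight a b hc hj0.symm t]
        simp only [hF, hK]
        ring
    _ = -∫ t in cube (m + 1), t 0 * (∏ i ∈ K, t i) * weight (m + 1) a b c t := integral_neg _

/-! ### Aomoto's recurrence for the moments -/

/-- The number of `j : Fin m` with `j+1 ∈ K` is `|K|` when `0 ∉ K`. [folklore] -/
theorem card_filter_succ_mem {K : Finset (Fin (m + 1))} (h0 : (0 : Fin (m + 1)) ∉ K) :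
    (Finset.univ.filter fun j : Fin m => j.succ ∈ K).card = K.card := by
  refine Finset.card_bij (fun j _ => j.succ) (fun j hj => (Finset.mem_filter.1 hj).2)
    (fun j₁ _ j₂ _ h => Fin.succ_injective _ h) fun i hi => ?_
  have hi0 : i ≠ 0 := fun h => h0 (h ▸ hi)
  obtain ⟨j, rfl⟩ := Fin.exists_succ_eq.2 hi0
  exact ⟨j, Finset.mem_filter.2 ⟨Finset.mem_univ _, hi⟩, rfl⟩

/-- **Aomoto's recurrence** (`0 ∉ K`, `a, b, c ≥ 1`):
`(a + (m - |K|)c) I(K) = (a + b + (2m - |K|)c) I(K ∪ {0})`, where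
`I(K) = ∫ (∏_{i∈K} tᵢ) W`. (AAR §8.2, the lemma behind Thm. 8.1.1.) [folklore] -/
theorem aomoto_recurrence (ha : 1 ≤ a) (hb : 1 ≤ b) (hc : 1 ≤ c) (K : Finset (Fin (m + 1)))
    (h0 : (0 : Fin (m + 1)) ∉ K) :
    (a + ((m : ℝ) - K.card) * c) * ∫ t in cube (m + 1), (∏ i ∈ K, t i) * weight (m + 1) a b c t =
      (a + b + (2 * (m : ℝ) - K.card) * c) *
        ∫ t in cube (m + 1), (∏ i ∈ insert 0 K, t i) * weight (m + 1) a b c t := by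
  set W := weight (m + 1) a b c with hW
  set IK := ∫ t in cube (m + 1), (∏ i ∈ K, t i) * W t with hIK
  set I0 := ∫ t in cube (m + 1), (∏ i ∈ insert 0 K, t i) * W t with hI0
  have hins : ∀ t : Fin (m + 1) → ℝ, ∏ i ∈ insert 0 K, t i = t 0 * ∏ i ∈ K, t i := fun t =>
    Finset.prod_insert h0
  -- continuity / integrability
  have hWc : Continuous W := continuous_weight ha hb (by linarith)
  have hec : Continuous fun t : Fin (m + 1) → ℝ => ∏ i ∈ K, t i :=
    continuous_finsetProd _ fun i _ => continuous_apply i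
  have hint : ∀ {F : (Fin (m + 1) → ℝ) → ℝ}, Continuous F → IntegrableOn F (cube (m + 1)) :=
    fun hF => hF.continuousOn.integrableOn_compact (isCompact_cube _)
  -- the three kinds of terms in the calculus identity
  have hA2 : ∫ t in cube (m + 1), t 0 * (∏ i ∈ K, t i) * W t = I0 := by
    rw [hI0]
    refine setIntegral_congr_fun (measurableSet_cube _) fun t _ => ?_
    rw [hins]
  have hA1 : ∫ t in cube (m + 1), (1 - t 0) * (∏ i ∈ K, t i) * W t = IK - I0 := by
    rw [← hA2, hIK, ← integral_sub (hint (by fun_prop)) (hint (by fun_prop))]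
    refine setIntegral_congr_fun (measurableSet_cube _) fun t _ => ?_
    ring
  have hBin : ∀ j : Fin m, j.succ ∈ K →
      2 * ∫ t in cube (m + 1), t 0 * (1 - t 0) * (∏ i ∈ K, t i) *
        dWeight (m + 1) a b c 0 j.succ t = -I0 := by
    intro j hj
    rw [two_mul_integral_dWeight_of_mem ha hb hc h0 hj, hA2]
  have hBout : ∀ j : Fin m, j.succ ∉ K →
      2 * ∫ t in cube (m + 1), t 0 * (1 - t 0) * (∏ i ∈ K, t i) *
        dWeight (m + 1) a b c 0 j.succ t = IK - 2 * I0 := by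
    intro j hj
    rw [two_mul_integral_dWeight_of_not_mem ha hb hc h0 (Fin.succ_ne_zero j) hj]
    have hIj : ∫ t in cube (m + 1), (∏ i ∈ insert j.succ K, t i) * W t = I0 := by
      simp only [hI0, hW]
      exact integral_prod_eq_of_card_eq (m + 1) a b c
        (by rw [Finset.card_insert_of_notMem hj, Finset.card_insert_of_notMem h0])
    have hinsj : ∀ t : Fin (m + 1) → ℝ, ∏ i ∈ insert j.succ K, t i = t j.succ * ∏ i ∈ K, t i :=
      fun t => Finset.prod_insert hj
    have e1 : ∫ t in cube (m + 1), (1 - t 0 - t j.succ) * (∏ i ∈ K, t i) * W t =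
        (∫ t in cube (m + 1), (1 - t 0) * (∏ i ∈ K, t i) * W t) -
          ∫ t in cube (m + 1), (∏ i ∈ insert j.succ K, t i) * W t := by
      rw [← integral_sub (hint (by fun_prop)) (hint (by simp only [hinsj]; fun_prop))]
      refine setIntegral_congr_fun (measurableSet_cube _) fun t _ => ?_
      rw [hinsj]
      ring
    rw [e1, hA1, hIj]
    ring
  -- sum over `j`
  have hsum : ∑ j : Fin m, 2 * ∫ t in cube (m + 1), t 0 * (1 - t 0) * (∏ i ∈ K, t i) *
      dWeight (m + 1) a b c 0 j.succ t = K.card * (-I0) + ((m : ℝ) - K.card) * (IK - 2 * I0) := by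
    rw [← Finset.sum_filter_add_sum_filter_not Finset.univ (fun j : Fin m => j.succ ∈ K)]
    rw [Finset.sum_congr rfl fun j hj => hBin j (Finset.mem_filter.1 hj).2,
      Finset.sum_congr rfl fun j hj => hBout j (Finset.mem_filter.1 hj).2,
      Finset.sum_const, Finset.sum_const, card_filter_succ_mem h0]
    have hcard : ((Finset.univ.filter fun j : Fin m => ¬j.succ ∈ K).card : ℝ) = m - K.card := by
      have h := Finset.card_filter_add_card_filter_not
        (s := (Finset.univ : Finset (Fin m))) (fun j : Fin m => j.succ ∈ K)
      rw [card_filter_succ_mem h0, Finset.card_univ, Fintype.card_fin] at h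
      have h' : ((K.card + (Finset.univ.filter fun j : Fin m => ¬j.succ ∈ K).card : ℕ) : ℝ) = m := by
        exact_mod_cast h
      push_cast at h'
      linarith
    rw [nsmul_eq_mul, nsmul_eq_mul, hcard]
  -- the calculus identity, doubled
  have hcalc := aomoto_calculus_identity ha hb hc K h0
  have hcalc2 : a * (IK - I0) - b * I0 +
      c * (K.card * (-I0) + ((m : ℝ) - K.card) * (IK - 2 * I0)) = 0 := by
    rw [← hsum, Finset.mul_sum, ← hA1, ← hA2]
    have e : ∀ j : Fin m, c * (2 * ∫ t in cube (m + 1), t 0 * (1 - t 0) * (∏ i ∈ K, t i) *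
        dWeight (m + 1) a b c 0 j.succ t) = 2 * c * ∫ t in cube (m + 1),
          t 0 * (1 - t 0) * (∏ i ∈ K, t i) * dWeight (m + 1) a b c 0 j.succ t := fun j => by ring
    simp only [e, ← Finset.mul_sum]
    simpa only [hW] using hcalc
  linear_combination hcalc2

/-! ### The recurrence for the Selberg integral -/

/-- The moments along the chain: for `|K| = k ≤ m+1`,
`I(K) = S_{m+1}(a,b,c) · ∏_{i<k} (a + (m-i)c)/(a + b + (2m-i)c)`. [folklore] -/
theorem integral_prod_eq_selbergIntegral_mul (ha : 1 ≤ a) (hb : 1 ≤ b) (hc : 1 ≤ c) (k : ℕ)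
    (hk : k ≤ m + 1) (K : Finset (Fin (m + 1))) (hK : K.card = k) :
    ∫ t in cube (m + 1), (∏ i ∈ K, t i) * weight (m + 1) a b c t =
      selbergIntegral (m + 1) a b c *
        ∏ i ∈ range k, (a + ((m : ℝ) - i) * c) / (a + b + (2 * (m : ℝ) - i) * c) := by
  induction k generalizing K with
  | zero =>
    rw [Finset.card_eq_zero] at hK
    subst hK
    simp [selbergIntegral_eq_integral_weight]
  | succ k ih =>
    -- choose a `k`-subset of the nonzero indices
    have hkm : k ≤ (Finset.univ.erase (0 : Fin (m + 1))).card := by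
      rw [Finset.card_erase_of_mem (Finset.mem_univ _), Finset.card_univ, Fintype.card_fin]
      omega
    obtain ⟨L, hLsub, hLcard⟩ := Finset.exists_subset_card_eq hkm
    have hL0 : (0 : Fin (m + 1)) ∉ L := fun h => by
      have := hLsub h
      simp at this
    have hIL := ih (by omega) L hLcard
    -- `I(K) = I(insert 0 L)` since both have size `k+1`
    have hcardK : K.card = (insert 0 L).card := by
      rw [Finset.card_insert_of_notMem hL0, hLcard, hK]
    rw [integral_prod_eq_of_card_eq (m + 1) a b c hcardK]
    -- Aomoto's recurrence
    have hrec := aomoto_recurrence ha hb hc L hL0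
    rw [hLcard, hIL] at hrec
    have hpos : 0 < a + b + (2 * (m : ℝ) - k) * c := by
      have : (k : ℝ) ≤ m := by exact_mod_cast (by omega : k ≤ m)
      nlinarith
    rw [prod_range_succ]
    set P := ∏ i ∈ range k, (a + ((m : ℝ) - i) * c) / (a + b + (2 * (m : ℝ) - i) * c) with hP
    set S := selbergIntegral (m + 1) a b c with hS
    rw [show S * (P * ((a + ((m : ℝ) - (k : ℕ)) * c) / (a + b + (2 * (m : ℝ) - (k : ℕ)) * c))) =
      ((a + ((m : ℝ) - k) * c) * (S * P)) / (a + b + (2 * (m : ℝ) - k) * c) by ring,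
      eq_div_iff hpos.ne']
    linear_combination -hrec

/-- **Aomoto's recurrence in `a` for the Selberg integral** (`a, b, c ≥ 1`):
`S_n(a+1, b, c) = S_n(a, b, c) · ∏_{j<n} (a + jc)/(a + b + (n+j-1)c)` for `n = m+1`.
Together with `selbergProduct_add_one` this shows both sides of Selberg's formula satisfy the same
first-order recurrence in `a` (AAR §8.2, Thm. 8.1.1). [folklore] -/
theorem selbergIntegral_add_one (ha : 1 ≤ a) (hb : 1 ≤ b) (hc : 1 ≤ c) :
    selbergIntegral (m + 1) (a + 1) b c = selbergIntegral (m + 1) a b c *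
      ∏ j ∈ range (m + 1), (a + j * c) / (a + b + (((m + 1 : ℕ) : ℝ) + j - 1) * c) := by
  -- `S(a+1) = I(univ)`
  have huniv : selbergIntegral (m + 1) (a + 1) b c =
      ∫ t in cube (m + 1), (∏ i ∈ Finset.univ, t i) * weight (m + 1) a b c t := by
    rw [selbergIntegral_eq_integral_weight]
    refine setIntegral_congr_fun (measurableSet_cube _) fun t ht => ?_
    rw [mem_cube_iff] at ht
    simp only [weight, body]
    rw [← mul_assoc, ← prod_mul_distrib]
    congr 1
    refine prod_congr rfl fun i _ => ?_
    rw [show a + 1 - 1 = (a - 1) + 1 by ring, Real.rpow_add_one' (ht i).1 (ne_of_gt (by linarith))]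
    ring
  rw [huniv, integral_prod_eq_selbergIntegral_mul ha hb hc (m + 1) le_rfl Finset.univ
    (by rw [Finset.card_univ, Fintype.card_fin])]
  congr 1
  rw [← Finset.prod_range_reflect]
  refine prod_congr rfl fun j hj => ?_
  rw [Finset.mem_range] at hj
  have e : ((m + 1 - 1 - j : ℕ) : ℝ) = m - j := by
    rw [Nat.cast_sub (by omega), Nat.cast_sub (by omega)]
    push_cast
    ring
  rw [e]
  push_cast
  congr 1 <;> ring

end Selberg

end Literature.Analysis.SpecialFunctions

end
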